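import Literature.Topology.FourManifolds.WeaklyReducibleTrisections
import Literature.Topology.FourManifolds.ClosedBallProofs
import HarnessLib

/-!
# Aranda–Zupan's vocabulary (curves, compressing discs, weak reducibility, reducibility) is
# natural under diffeomorphisms

Topic `Literature/Topology/FourManifolds`; companion of `WeaklyReducibleTrisections.lean` (the
vocabulary `Trisection.centralSurfaceSet / spineHandlebody / IsNonSeparating / IsCurve /
BoundsDisc / IsWeaklyReducible / IsReducible` of Aranda–Zupan 2025, §2) and of
`TrisectionFunctorGKNaturality.lean`, `TrisectionShrink.lean` (naturality of `IsGKTrisection`).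
A diffeomorphism `Φ : X ≅ X'` of smooth 4-manifolds — in ARBITRARY universes — carrying sectors
`S i` to sectors `Φ '' S i` carries the central surface and the handlebodies of the spine to
those of the image (`centralSurfaceSet_image`, `spineHandlebody_image`: images commute with
intersections for a bijection), curves to curves and compressing discs to compressing discs
(composition of a smooth embedding of `S¹` / `𝔻²` with `Φ`,
`Manifold.IsSmoothEmbedding.diffeomorph_comp`), non-separating curves to non-separating curves
(a homeomorphism suffices), hence weak reductions to weak reductions and reducing curves to
reducing curves; with `Φ⁻¹` the four notions are INVARIANT (`…_image_diffeomorph_iff`).  This is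
the tacit invariance under diffeomorphism of Aranda–Zupan's definitions (§2, p. 6: properties of
the trisection `T = (Σ; H_α, H_β, H_γ)` "up to diffeomorphism of trisected manifolds"); it is the
bottom layer of the universe bookkeeping of the Aranda–Zupan fact
(`Literature/Barriers/SmoothPoincare4/WeaklyReducibleGenusThreeStandardProofs.lean`).
Everything here is proved; no named fact is introduced.

## References

* R. Aranda, A. Zupan, *Manifolds with weakly reducible genus-three trisections are standard*,
  arXiv:2503.04607 (2025), §2 (pp. 3–6). [ArandaZupan2025]
-/

noncomputable section

open scoped Manifold ContDiff Topology
open Set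

namespace Literature.Topology.FourManifolds

universe u v

namespace Trisection

/-! ### Set level: central surface and handlebodies of the image sectors -/

section SetLevel

variable {X : Type u} {X' : Type v}

/-- The central surface of the image sectors is the image of the central surface (for a
bijection `f`). [folklore] -/
theorem centralSurfaceSet_image (S : Fin 3 → Set X) {f : X → X'} (hf : Function.Bijective f) :
    centralSurfaceSet (fun i => f '' S i) = f '' centralSurfaceSet S :=
  (image_iInter hf S).symm

/-- The handlebody of the spine of the image sectors opposite `p` is the image of the handlebody
opposite `p` (for an injection `f`). [folklore] -/
theorem spineHandlebody_image (S : Fin 3 → Set X) {f : X → X'} (hf : Function.Injective f)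
    (p : Fin 3) : spineHandlebody (fun i => f '' S i) p = f '' spineHandlebody S p := by
  rw [spineHandlebody_eq_inter, spineHandlebody_eq_inter, image_inter hf]

end SetLevel

/-! ### Non-separating curves (homeomorphisms suffice) -/

section Topological

variable {X : Type u} {X' : Type v} [TopologicalSpace X] [TopologicalSpace X']

/-- **A homeomorphism carries non-separating curves to non-separating curves**:
`Φ '' (Σ ∖ c) = Φ(Σ) ∖ Φ(c)` is connected. [cite: ArandaZupan2025, §2 (p. 6)] -/
theorem IsNonSeparating.image_homeomorph {S : Fin 3 → Set X} {c : Set X}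
    (h : IsNonSeparating S c) (Φ : X ≃ₜ X') :
    IsNonSeparating (fun i => Φ '' S i) (Φ '' c) := by
  unfold IsNonSeparating at h ⊢
  rw [centralSurfaceSet_image S Φ.bijective, ← image_sdiff Φ.injective]
  exact h.image Φ Φ.continuous.continuousOn

/-- Non-separation is invariant under homeomorphisms. [cite: ArandaZupan2025, §2 (p. 6)] -/
theorem isNonSeparating_image_homeomorph_iff (S : Fin 3 → Set X) (c : Set X) (Φ : X ≃ₜ X') :
    IsNonSeparating (fun i => Φ '' S i) (Φ '' c) ↔ IsNonSeparating S c := by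
  refine ⟨fun h => ?_, fun h => h.image_homeomorph Φ⟩
  have h' := h.image_homeomorph Φ.symm
  simp only [Homeomorph.image_symm, Homeomorph.preimage_image] at h'
  exact h'

end Topological

/-! ### Curves, compressing discs, (weak) reducibility under diffeomorphisms -/

section Smooth

variable {X : Type u} [TopologicalSpace X] [ChartedSpace (EuclideanSpace ℝ (Fin 4)) X] [IsManifold (𝓡 4) ∞ X]
  {X' : Type v} [TopologicalSpace X'] [ChartedSpace (EuclideanSpace ℝ (Fin 4)) X'] [IsManifold (𝓡 4) ∞ X']

/-- **A diffeomorphism carries curves on `Σ` to curves on `Φ(Σ)`** (the smoothly embedded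
circle `γ` becomes `Φ ∘ γ`). [cite: ArandaZupan2025, §2 (p. 3)] -/
theorem IsCurve.image_diffeomorph {S : Fin 3 → Set X} {c : Set X} (h : IsCurve S c)
    (Φ : X ≃ₘ⟮𝓡 4, 𝓡 4⟯ X') : IsCurve (fun i => Φ '' S i) (Φ '' c) := by
  obtain ⟨hcF, γ, hγ, hrange⟩ := h
  refine ⟨?_, Φ ∘ γ, hγ.diffeomorph_comp Φ, ?_⟩
  · rw [centralSurfaceSet_image S (EquivLike.bijective Φ)]
    exact image_mono hcF
  · rw [range_comp, hrange]

/-- **A diffeomorphism carries compressing discs to compressing discs**: if `c` bounds a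
properly embedded smooth disc `d` in `A` (relative to `Σ`), then `Φ(c)` bounds `Φ ∘ d` in `Φ(A)`
(relative to `Φ(Σ)`). [cite: ArandaZupan2025, §2 (p. 3)] -/
theorem BoundsDisc.image_diffeomorph {S : Fin 3 → Set X} {A c : Set X} (h : BoundsDisc S A c)
    (Φ : X ≃ₘ⟮𝓡 4, 𝓡 4⟯ X') : BoundsDisc (fun i => Φ '' S i) (Φ '' A) (Φ '' c) := by
  obtain ⟨d, hd, hdA, hdb, hdF⟩ := h
  have hinj : Function.Injective Φ := EquivLike.injective Φ
  refine ⟨Φ ∘ d, hd.diffeomorph_comp Φ, ?_, ?_, ?_⟩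
  · rw [range_comp]
    exact image_mono hdA
  · rw [image_comp, hdb]
  · rw [range_comp, centralSurfaceSet_image S (EquivLike.bijective Φ), ← image_inter hinj, hdF]

/-- **A diffeomorphism carries weak reductions to weak reductions**: the images of the two
curves `c ⊂ H_p`, `c′ ⊂ H_q (q ≠ p)` of a weak reduction of `S` form a weak reduction of the
image sectors, at the same label `p`. [cite: ArandaZupan2025, §2 (p. 6)] -/
theorem IsWeaklyReducible.image_diffeomorph {S : Fin 3 → Set X} (h : IsWeaklyReducible S)
    (Φ : X ≃ₘ⟮𝓡 4, 𝓡 4⟯ X') : IsWeaklyReducible (fun i => Φ '' S i) := by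
  obtain ⟨p, c, c', hc, hc', hd, hn, hn', hb, hb'⟩ := h
  have hinj : Function.Injective Φ := EquivLike.injective Φ
  refine ⟨p, Φ '' c, Φ '' c', hc.image_diffeomorph Φ, hc'.image_diffeomorph Φ,
    (disjoint_image_iff hinj).2 hd, hn.image_homeomorph Φ.toHomeomorph,
    hn'.image_homeomorph Φ.toHomeomorph, ?_, fun q hq => ?_⟩
  · rw [spineHandlebody_image S hinj]
    exact hb.image_diffeomorph Φ
  · rw [spineHandlebody_image S hinj]
    exact (hb' q hq).image_diffeomorph Φ

/-- **A diffeomorphism carries reducing curves to reducing curves**: the image of an essential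
curve on `Σ` bounding compressing discs in all three handlebodies is such a curve for the image
sectors (essentiality is preserved because a disc inside `Φ(Σ)` bounding `Φ(δ)` would pull back
along `Φ⁻¹` to a disc inside `Σ` bounding `δ`). [cite: ArandaZupan2025, §2 (p. 6)] -/
theorem IsReducible.image_diffeomorph {S : Fin 3 → Set X} (h : IsReducible S)
    (Φ : X ≃ₘ⟮𝓡 4, 𝓡 4⟯ X') : IsReducible (fun i => Φ '' S i) := by
  obtain ⟨δ, hδ, hess, hb⟩ := h
  have hinj : Function.Injective Φ := EquivLike.injective Φ
  refine ⟨Φ '' δ, hδ.image_diffeomorph Φ, ?_, fun q => ?_⟩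
  · rintro ⟨e, he, heF, heb⟩
    refine hess ⟨Φ.symm ∘ e, he.diffeomorph_comp Φ.symm, ?_, ?_⟩
    · rw [range_comp]
      rw [centralSurfaceSet_image S (EquivLike.bijective Φ)] at heF
      calc Φ.symm '' range e ⊆ Φ.symm '' (Φ '' centralSurfaceSet S) := image_mono heF
        _ = centralSurfaceSet S := Φ.symm_image_image _
    · rw [image_comp, heb, Φ.symm_image_image]
  · rw [spineHandlebody_image S hinj]
    exact (hb q).image_diffeomorph Φ

/-- Weak reducibility is invariant under diffeomorphisms. [cite: ArandaZupan2025, §2 (p. 6)] -/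
theorem isWeaklyReducible_image_diffeomorph_iff (S : Fin 3 → Set X) (Φ : X ≃ₘ⟮𝓡 4, 𝓡 4⟯ X') :
    IsWeaklyReducible (fun i => Φ '' S i) ↔ IsWeaklyReducible S := by
  refine ⟨fun h => ?_, fun h => h.image_diffeomorph Φ⟩
  have h' := h.image_diffeomorph Φ.symm
  simp only [Diffeomorph.symm_image_image] at h'
  exact h'

/-- Reducibility is invariant under diffeomorphisms. [cite: ArandaZupan2025, §2 (p. 6)] -/
theorem isReducible_image_diffeomorph_iff (S : Fin 3 → Set X) (Φ : X ≃ₘ⟮𝓡 4, 𝓡 4⟯ X') :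
    IsReducible (fun i => Φ '' S i) ↔ IsReducible S := by
  refine ⟨fun h => ?_, fun h => h.image_diffeomorph Φ⟩
  have h' := h.image_diffeomorph Φ.symm
  simp only [Diffeomorph.symm_image_image] at h'
  exact h'

/-- Curves on `Σ` are invariant under diffeomorphisms. [cite: ArandaZupan2025, §2 (p. 3)] -/
theorem isCurve_image_diffeomorph_iff (S : Fin 3 → Set X) (c : Set X)
    (Φ : X ≃ₘ⟮𝓡 4, 𝓡 4⟯ X') : IsCurve (fun i => Φ '' S i) (Φ '' c) ↔ IsCurve S c := by
  refine ⟨fun h => ?_, fun h => h.image_diffeomorph Φ⟩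
  have h' := h.image_diffeomorph Φ.symm
  simp only [Diffeomorph.symm_image_image] at h'
  exact h'

/-- Compressing discs are invariant under diffeomorphisms. [cite: ArandaZupan2025, §2 (p. 3)] -/
theorem boundsDisc_image_diffeomorph_iff (S : Fin 3 → Set X) (A c : Set X)
    (Φ : X ≃ₘ⟮𝓡 4, 𝓡 4⟯ X') :
    BoundsDisc (fun i => Φ '' S i) (Φ '' A) (Φ '' c) ↔ BoundsDisc S A c := by
  refine ⟨fun h => ?_, fun h => h.image_diffeomorph Φ⟩
  have h' := h.image_diffeomorph Φ.symm
  simp only [Diffeomorph.symm_image_image] at h'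
  exact h'

end Smooth

end Trisection

end Literature.Topology.FourManifolds

end
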